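import Mathlib
import Summits.NavierStokesRegularity.NavierStokesRegularity.Theorems.EulerZoomLiouvillePowerGaugeEulerLiouvilleNeedleResidenceHyperbolic

/-!
# SUBCRITICAL STRAIN CLOCKS along lingering backward cut-off orbits (plate t40d of ROUND-40, nsreg-p2 g33's spec)

Width piece for crux `EulerZoomLiouville.PowerGaugeEulerLiouville` (stmt-NavierStokesRegularity-19832), by name under
LEAD 19832 (ns-typeII-p2 g12); seat ns-ezl-w5 g3, `--supports stmt-NavierStokesRegularity-19832 --as helper`.

Setting (binders VERBATIM from t40a `norm_curl_flow_eq_linger`): `(U, P)` a self-similar Euler profile, `V ∈ C²` a cut-off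
copy (`‖DV‖ ≤ K`, `V = U` on `ball 0 R_big`), `M < R_big`, `Ψ_σ := Φ^V_{−σ}` the backward cut-off similarity flow,
`J_σ := DΨ_σ(y)`, and a label `y` whose backward orbit LINGERS in `B̄_M` during `[0, L]`.

* `hasDerivAt_norm_fderiv_flow_apply_sq` — the transported line element obeys
  `d/dσ ‖J_σ v‖² = −2γ‖J_σ v‖² − 2⟪DU(Ψ_σ y)(J_σ v), J_σ v⟫` on `[0, L]` (t40b's backward variational equation, `DV = DU`
  inside the ball);
* (S1) `norm_fderiv_flow_apply_ge_linger` — GRÖNWALL LOWER: if the STRETCHING RATE is bounded on `B̄_M`,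
  `⟪DU z v, v⟫ ≤ s‖v‖²`, then `e^{−(γ+s)σ}‖v‖ ≤ ‖J_σ v‖` (`e^{2(γ+s)σ}‖J_σ v‖²` is monotone);
* (S2) `norm_fderiv_flow_apply_le_linger`, `norm_fderiv_flow_le_linger` — GRÖNWALL UPPER: if the COMPRESSION RATE is
  bounded on `B̄_M`, `−k‖v‖² ≤ ⟪DU z v, v⟫`, then `‖J_σ v‖ ≤ e^{(k−γ)σ}‖v‖`, `‖J_σ‖ ≤ e^{(k−γ)σ}`;
* (S3) `norm_curl_mul_exp_le_curl_flow_of_stretching_linger`, `norm_curl_mul_exp_le_of_stretching_linger` — THE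
  STRETCHING CLOCK: `‖curl U y‖·e^{(1−s)σ} ≤ ‖curl U (Ψ_σ y)‖ ≤ O` (`O ≥ sup_{B̄_M}‖curl U‖`): t40a's local Cauchy formula
  `‖Ω(Ψ_σ y)‖ = e^{(1+γ)σ}‖J_σ Ω(y)‖` with (S1) at `v = Ω(y)`;
* (S4) `norm_curl_mul_exp_le_of_compression_linger` — THE COMPRESSION CLOCK: `‖curl U y‖·e^{(1−2k)σ} ≤ O`: t40c's
  hyperbolicity `‖Ω(y)‖e^{(1−2γ)σ} ≤ O‖J_σ‖²` with (S2)².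
* `linger_time_le_of_stretching`, `linger_time_le_of_compression` — the two RESIDENCE-TIME BOUNDS read off (S3)/(S4):
  a label with `‖Ω(y)‖ > 0` lingers in `B̄_M` at most `log(O/‖Ω(y)‖)/(1−s)` if `s < 1`, at most `log(O/‖Ω(y)‖)/(1−2k)`
  if `k < 1/2`.

REMARK (why STRETCHING is the weaker clock hypothesis).  On the ball `div U = 0`, so `tr DU(z) = 0`; if
`λ_min(sym DU(z)) ≥ −k` then `λ_max(sym DU(z)) ≤ 2k`, i.e. the compression hypothesis of (S4) with `k < 1/2` implies the
stretching hypothesis of (S3) with `s = 2k < 1` and the SAME rate `1 − 2k`; the converse fails (eigenvalues `(s, s, −2s)`).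
Both thresholds are SHARP exactly at vortical `W`-nodes (there `DU·Ω̂ = Ω̂`: stretching `1`, transverse compressions
summing to `1`) — the finite-time, cut-off-local form of the LEAD's `curl_eq_zero_of_backward_orbit_stretching_lt`
(…SelfSimilarSourceExclusion; `C^∞`, global, infinite time).

HONEST FRAMING: statements about the flow of HYPOTHETICAL self-similar Euler profiles (blow-up needles); nothing here proves
the crux E `PowerGaugeEulerLiouville` (19832 OPEN), any door Target, or any Navier–Stokes regularity statement; no summit
statement is touched.  [cite: ConstantinIgnatovaVicol2026Putative, §3.4.1 eq. (3.22)–(3.24); folklore (Grönwall)]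
-/

noncomputable section

open Set Filter Topology Metric Function MeasureTheory
open scoped RealInnerProductSpace NNReal ENNReal

set_option linter.dupNamespace false

namespace Summit.NavierStokesRegularity.NavierStokesRegularity.Theorems.PowerGaugeEulerLiouville.NeedleClock

open Literature.Analysis Literature.Analysis.FluidPDE
open Summit.NavierStokesRegularity.NavierStokesRegularity.Theorems.PowerGaugeEulerLiouville

variable {γ : ℝ} {U V : EuclideanSpace ℝ (Fin 3) → EuclideanSpace ℝ (Fin 3)} {P : EuclideanSpace ℝ (Fin 3) → ℝ}

/-! ## The transported line element along a lingering orbit -/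

/-- **Evolution of a transported line element, inside the ball.**  `V ∈ C²`, `‖DV‖ ≤ K`, `V = U` on `ball 0 R_big`,
`M < R_big`; along a backward orbit lingering in `B̄_M` during `[0, L]`, for every `σ ∈ [0, L]` and every vector `v`:
`d/dσ ‖J_σ v‖² = −2γ‖J_σ v‖² − 2⟪DU(Ψ_σ y)(J_σ v), J_σ v⟫`, `J_σ = DΨ_σ(y)`.
[cite: ConstantinIgnatovaVicol2026Putative, §3.4.1 eq. (3.22)] -/
theorem hasDerivAt_norm_fderiv_flow_apply_sq (hV : ContDiff ℝ 2 V) {K : ℝ} (hK : ∀ y, ‖fderiv ℝ V y‖ ≤ K)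
    {M Rbig : ℝ} (hMR : M < Rbig) (hVU : ∀ w ∈ ball (0 : EuclideanSpace ℝ (Fin 3)) Rbig, V w = U w)
    {y : EuclideanSpace ℝ (Fin 3)} {L : ℝ}
    (hy : ∀ σ ∈ Icc (0 : ℝ) L, ‖ODE.evolutionMap (fun _ : ℝ => selfSimilarTransport γ 0 V) 0 (-σ) y‖ ≤ M)
    (v : EuclideanSpace ℝ (Fin 3)) {σ : ℝ} (hσ : σ ∈ Icc (0 : ℝ) L) :
    HasDerivAt (fun r => ‖fderiv ℝ (ODE.evolutionMap (fun _ : ℝ => selfSimilarTransport γ 0 V) 0 (-r)) y v‖ ^ 2)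
      (-(2 * γ) * ‖fderiv ℝ (ODE.evolutionMap (fun _ : ℝ => selfSimilarTransport γ 0 V) 0 (-σ)) y v‖ ^ 2 -
        2 * ⟪fderiv ℝ U (ODE.evolutionMap (fun _ : ℝ => selfSimilarTransport γ 0 V) 0 (-σ) y)
              (fderiv ℝ (ODE.evolutionMap (fun _ : ℝ => selfSimilarTransport γ 0 V) 0 (-σ)) y v),
            fderiv ℝ (ODE.evolutionMap (fun _ : ℝ => selfSimilarTransport γ 0 V) 0 (-σ)) y v⟫) σ := by
  have hz : ODE.evolutionMap (fun _ : ℝ => selfSimilarTransport γ 0 V) 0 (-σ) y ∈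
      ball (0 : EuclideanSpace ℝ (Fin 3)) Rbig :=
    mem_ball_zero_iff.2 (lt_of_le_of_lt (hy σ hσ) hMR)
  have h := (hasDerivAt_fderiv_flow_neg_apply (γ := γ) hV hK y v σ).norm_sq
  refine h.congr_deriv ?_
  rw [fderiv_eq_of_agree_ball hVU hz, inner_neg_right, inner_add_right, real_inner_smul_right,
    real_inner_self_eq_norm_sq, real_inner_comm]
  ring

/-! ## (S1) Grönwall LOWER bound under a stretching bound -/

/-- **(S1) GRÖNWALL LOWER BOUND under a stretching bound.**  If the stretching rate of the profile is bounded on `B̄_M`,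
`⟪DU(z) v, v⟫ ≤ s‖v‖²` (`z ∈ B̄_M`, all `v`), then along every backward cut-off orbit lingering in `B̄_M` during `[0, L]`,
for every `σ ∈ [0, L]` and every `v`: `e^{−(γ+s)σ}‖v‖ ≤ ‖DΨ_σ(y) v‖`.
Proof: `φ(σ) = ‖J_σ v‖²` has `φ′ ≥ −2(γ+s)φ`, so `e^{2(γ+s)σ}φ(σ)` is monotone on `[0, L]` and `≥ φ(0) = ‖v‖²`.
[cite: ConstantinIgnatovaVicol2026Putative, §3.4.1 eq. (3.22)] -/
theorem norm_fderiv_flow_apply_ge_linger (hV : ContDiff ℝ 2 V) {K : ℝ} (hK : ∀ y, ‖fderiv ℝ V y‖ ≤ K)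
    {M Rbig : ℝ} (hMR : M < Rbig) (hVU : ∀ w ∈ ball (0 : EuclideanSpace ℝ (Fin 3)) Rbig, V w = U w) {s : ℝ}
    (hs : ∀ z ∈ closedBall (0 : EuclideanSpace ℝ (Fin 3)) M, ∀ v : EuclideanSpace ℝ (Fin 3),
      ⟪fderiv ℝ U z v, v⟫ ≤ s * ‖v‖ ^ 2)
    {y : EuclideanSpace ℝ (Fin 3)} {L : ℝ}
    (hy : ∀ σ ∈ Icc (0 : ℝ) L, ‖ODE.evolutionMap (fun _ : ℝ => selfSimilarTransport γ 0 V) 0 (-σ) y‖ ≤ M)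
    {σ : ℝ} (hσ : σ ∈ Icc (0 : ℝ) L) (v : EuclideanSpace ℝ (Fin 3)) :
    Real.exp (-((γ + s) * σ)) * ‖v‖ ≤
      ‖fderiv ℝ (ODE.evolutionMap (fun _ : ℝ => selfSimilarTransport γ 0 V) 0 (-σ)) y v‖ := by
  -- notation
  set J : ℝ → (EuclideanSpace ℝ (Fin 3) →L[ℝ] EuclideanSpace ℝ (Fin 3)) := fun r =>
    fderiv ℝ (ODE.evolutionMap (fun _ : ℝ => selfSimilarTransport γ 0 V) 0 (-r)) y with hJ
  set φ : ℝ → ℝ := fun r => ‖J r v‖ ^ 2 with hφ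
  set ψ : ℝ → ℝ := fun r => Real.exp (2 * (γ + s) * r) * φ r with hψ
  -- derivative of `φ` everywhere (for differentiability / continuity) and its value on `[0, L]`
  have hφ' : ∀ r, HasDerivAt φ (2 * ⟪J r v, -(γ • J r v +
      fderiv ℝ V (ODE.evolutionMap (fun _ : ℝ => selfSimilarTransport γ 0 V) 0 (-r) y) (J r v))⟫) r :=
    fun r => (hasDerivAt_fderiv_flow_neg_apply (γ := γ) hV hK y v r).norm_sq
  have hφ'I : ∀ r ∈ Icc (0 : ℝ) L, HasDerivAt φ (-(2 * γ) * ‖J r v‖ ^ 2 -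
      2 * ⟪fderiv ℝ U (ODE.evolutionMap (fun _ : ℝ => selfSimilarTransport γ 0 V) 0 (-r) y) (J r v), J r v⟫) r :=
    fun r hr => hasDerivAt_norm_fderiv_flow_apply_sq (γ := γ) hV hK hMR hVU hy v hr
  -- derivative of `ψ`
  have hexp : ∀ r, HasDerivAt (fun r => Real.exp (2 * (γ + s) * r)) (Real.exp (2 * (γ + s) * r) * (2 * (γ + s))) r :=
    fun r => by simpa using ((hasDerivAt_id r).const_mul (2 * (γ + s))).exp
  have hψ' : ∀ r, HasDerivAt ψ (Real.exp (2 * (γ + s) * r) * (2 * (γ + s)) * φ r +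
      Real.exp (2 * (γ + s) * r) * (2 * ⟪J r v, -(γ • J r v +
        fderiv ℝ V (ODE.evolutionMap (fun _ : ℝ => selfSimilarTransport γ 0 V) 0 (-r) y) (J r v))⟫)) r :=
    fun r => (hexp r).mul (hφ' r)
  -- `ψ` is monotone on `[0, L]`
  have hmono : MonotoneOn ψ (Icc 0 L) := by
    refine monotoneOn_of_deriv_nonneg (convex_Icc 0 L) (fun r _ => (hψ' r).continuousAt.continuousWithinAt)
      (fun r _ => (hψ' r).differentiableAt.differentiableWithinAt) ?_
    intro r hr
    rw [interior_Icc] at hr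
    have hrI : r ∈ Icc (0 : ℝ) L := Ioo_subset_Icc_self hr
    have hd : HasDerivAt ψ (Real.exp (2 * (γ + s) * r) * (2 * (γ + s)) * φ r +
        Real.exp (2 * (γ + s) * r) * (-(2 * γ) * ‖J r v‖ ^ 2 -
          2 * ⟪fderiv ℝ U (ODE.evolutionMap (fun _ : ℝ => selfSimilarTransport γ 0 V) 0 (-r) y) (J r v), J r v⟫)) r :=
      (hexp r).mul (hφ'I r hrI)
    rw [hd.deriv]
    have hzM : ODE.evolutionMap (fun _ : ℝ => selfSimilarTransport γ 0 V) 0 (-r) y ∈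
        closedBall (0 : EuclideanSpace ℝ (Fin 3)) M := mem_closedBall_zero_iff.2 (hy r hrI)
    have hsr := hs _ hzM (J r v)
    have hE : 0 < Real.exp (2 * (γ + s) * r) := Real.exp_pos _
    have hφ0 : 0 ≤ φ r := by positivity
    have : 0 ≤ 2 * (γ + s) * φ r + (-(2 * γ) * ‖J r v‖ ^ 2 -
        2 * ⟪fderiv ℝ U (ODE.evolutionMap (fun _ : ℝ => selfSimilarTransport γ 0 V) 0 (-r) y) (J r v), J r v⟫) := by
      simp only [hφ]
      nlinarith [hsr]
    calc (0 : ℝ) ≤ Real.exp (2 * (γ + s) * r) * (2 * (γ + s) * φ r + (-(2 * γ) * ‖J r v‖ ^ 2 -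
        2 * ⟪fderiv ℝ U (ODE.evolutionMap (fun _ : ℝ => selfSimilarTransport γ 0 V) 0 (-r) y) (J r v), J r v⟫)) :=
          mul_nonneg hE.le this
      _ = _ := by ring
  -- compare `ψ σ` with `ψ 0 = ‖v‖²`
  have hΦ0 : ODE.evolutionMap (fun _ : ℝ => selfSimilarTransport γ 0 V) 0 0 = id :=
    funext (ODE.evolutionMap_self _ 0)
  have hψ0 : ψ 0 = ‖v‖ ^ 2 := by
    simp only [hψ, hφ, hJ, mul_zero, Real.exp_zero, one_mul, neg_zero, hΦ0, fderiv_id,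
      ContinuousLinearMap.coe_id', id_eq]
  have hL : (0 : ℝ) ≤ L := hσ.1.trans hσ.2
  have hle : ψ 0 ≤ ψ σ := hmono (left_mem_Icc.2 hL) hσ hσ.1
  rw [hψ0] at hle
  -- take square roots
  have hsq : (Real.exp (-((γ + s) * σ)) * ‖v‖) ^ 2 ≤ ‖J σ v‖ ^ 2 := by
    have h2 : (Real.exp (-((γ + s) * σ)) * ‖v‖) ^ 2 = Real.exp (-(2 * (γ + s) * σ)) * ‖v‖ ^ 2 := by
      rw [mul_pow, ← Real.exp_nat_mul]; ring_nf
    have h3 : Real.exp (-(2 * (γ + s) * σ)) * (Real.exp (2 * (γ + s) * σ) * φ σ) = φ σ := by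
      rw [← mul_assoc, ← Real.exp_add, neg_add_cancel, Real.exp_zero, one_mul]
    rw [h2]
    calc Real.exp (-(2 * (γ + s) * σ)) * ‖v‖ ^ 2
        ≤ Real.exp (-(2 * (γ + s) * σ)) * (Real.exp (2 * (γ + s) * σ) * φ σ) :=
          mul_le_mul_of_nonneg_left hle (Real.exp_pos _).le
      _ = ‖J σ v‖ ^ 2 := by rw [h3]
  exact (pow_le_pow_iff_left₀ (by positivity) (norm_nonneg _) two_ne_zero).1 hsq

/-! ## (S2) Grönwall UPPER bound under a compression bound -/

/-- **(S2) GRÖNWALL UPPER BOUND under a compression bound, applied form.**  If the compression rate of the profile is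
bounded on `B̄_M`, `−k‖v‖² ≤ ⟪DU(z) v, v⟫` (`z ∈ B̄_M`, all `v`), then along every backward cut-off orbit lingering in `B̄_M`
during `[0, L]`, for every `σ ∈ [0, L]` and every `v`: `‖DΨ_σ(y) v‖ ≤ e^{(k−γ)σ}‖v‖`
(`e^{−2(k−γ)σ}‖J_σ v‖²` is antitone on `[0, L]`). [cite: ConstantinIgnatovaVicol2026Putative, §3.4.1 eq. (3.22)] -/
theorem norm_fderiv_flow_apply_le_linger (hV : ContDiff ℝ 2 V) {K : ℝ} (hK : ∀ y, ‖fderiv ℝ V y‖ ≤ K)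
    {M Rbig : ℝ} (hMR : M < Rbig) (hVU : ∀ w ∈ ball (0 : EuclideanSpace ℝ (Fin 3)) Rbig, V w = U w) {k : ℝ}
    (hk : ∀ z ∈ closedBall (0 : EuclideanSpace ℝ (Fin 3)) M, ∀ v : EuclideanSpace ℝ (Fin 3),
      -(k * ‖v‖ ^ 2) ≤ ⟪fderiv ℝ U z v, v⟫)
    {y : EuclideanSpace ℝ (Fin 3)} {L : ℝ}
    (hy : ∀ σ ∈ Icc (0 : ℝ) L, ‖ODE.evolutionMap (fun _ : ℝ => selfSimilarTransport γ 0 V) 0 (-σ) y‖ ≤ M)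
    {σ : ℝ} (hσ : σ ∈ Icc (0 : ℝ) L) (v : EuclideanSpace ℝ (Fin 3)) :
    ‖fderiv ℝ (ODE.evolutionMap (fun _ : ℝ => selfSimilarTransport γ 0 V) 0 (-σ)) y v‖ ≤
      Real.exp ((k - γ) * σ) * ‖v‖ := by
  -- notation
  set J : ℝ → (EuclideanSpace ℝ (Fin 3) →L[ℝ] EuclideanSpace ℝ (Fin 3)) := fun r =>
    fderiv ℝ (ODE.evolutionMap (fun _ : ℝ => selfSimilarTransport γ 0 V) 0 (-r)) y with hJ
  set φ : ℝ → ℝ := fun r => ‖J r v‖ ^ 2 with hφ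
  set ψ : ℝ → ℝ := fun r => Real.exp (-(2 * (k - γ) * r)) * φ r with hψ
  have hφ' : ∀ r, HasDerivAt φ (2 * ⟪J r v, -(γ • J r v +
      fderiv ℝ V (ODE.evolutionMap (fun _ : ℝ => selfSimilarTransport γ 0 V) 0 (-r) y) (J r v))⟫) r :=
    fun r => (hasDerivAt_fderiv_flow_neg_apply (γ := γ) hV hK y v r).norm_sq
  have hφ'I : ∀ r ∈ Icc (0 : ℝ) L, HasDerivAt φ (-(2 * γ) * ‖J r v‖ ^ 2 -
      2 * ⟪fderiv ℝ U (ODE.evolutionMap (fun _ : ℝ => selfSimilarTransport γ 0 V) 0 (-r) y) (J r v), J r v⟫) r :=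
    fun r hr => hasDerivAt_norm_fderiv_flow_apply_sq (γ := γ) hV hK hMR hVU hy v hr
  have hexp : ∀ r, HasDerivAt (fun r => Real.exp (-(2 * (k - γ) * r)))
      (Real.exp (-(2 * (k - γ) * r)) * (-(2 * (k - γ)))) r :=
    fun r => by simpa using (((hasDerivAt_id r).const_mul (2 * (k - γ))).neg).exp
  have hψ' : ∀ r, HasDerivAt ψ (Real.exp (-(2 * (k - γ) * r)) * (-(2 * (k - γ))) * φ r +
      Real.exp (-(2 * (k - γ) * r)) * (2 * ⟪J r v, -(γ • J r v +
        fderiv ℝ V (ODE.evolutionMap (fun _ : ℝ => selfSimilarTransport γ 0 V) 0 (-r) y) (J r v))⟫)) r :=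
    fun r => (hexp r).mul (hφ' r)
  -- `ψ` is antitone on `[0, L]`
  have hanti : AntitoneOn ψ (Icc 0 L) := by
    refine antitoneOn_of_deriv_nonpos (convex_Icc 0 L) (fun r _ => (hψ' r).continuousAt.continuousWithinAt)
      (fun r _ => (hψ' r).differentiableAt.differentiableWithinAt) ?_
    intro r hr
    rw [interior_Icc] at hr
    have hrI : r ∈ Icc (0 : ℝ) L := Ioo_subset_Icc_self hr
    have hd : HasDerivAt ψ (Real.exp (-(2 * (k - γ) * r)) * (-(2 * (k - γ))) * φ r +
        Real.exp (-(2 * (k - γ) * r)) * (-(2 * γ) * ‖J r v‖ ^ 2 -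
          2 * ⟪fderiv ℝ U (ODE.evolutionMap (fun _ : ℝ => selfSimilarTransport γ 0 V) 0 (-r) y) (J r v), J r v⟫)) r :=
      (hexp r).mul (hφ'I r hrI)
    rw [hd.deriv]
    have hzM : ODE.evolutionMap (fun _ : ℝ => selfSimilarTransport γ 0 V) 0 (-r) y ∈
        closedBall (0 : EuclideanSpace ℝ (Fin 3)) M := mem_closedBall_zero_iff.2 (hy r hrI)
    have hkr := hk _ hzM (J r v)
    have hE : 0 < Real.exp (-(2 * (k - γ) * r)) := Real.exp_pos _
    have : -(2 * (k - γ)) * φ r + (-(2 * γ) * ‖J r v‖ ^ 2 -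
        2 * ⟪fderiv ℝ U (ODE.evolutionMap (fun _ : ℝ => selfSimilarTransport γ 0 V) 0 (-r) y) (J r v), J r v⟫) ≤ 0 := by
      simp only [hφ]
      nlinarith [hkr]
    calc Real.exp (-(2 * (k - γ) * r)) * (-(2 * (k - γ))) * φ r + Real.exp (-(2 * (k - γ) * r)) *
          (-(2 * γ) * ‖J r v‖ ^ 2 -
            2 * ⟪fderiv ℝ U (ODE.evolutionMap (fun _ : ℝ => selfSimilarTransport γ 0 V) 0 (-r) y) (J r v), J r v⟫)
        = Real.exp (-(2 * (k - γ) * r)) * (-(2 * (k - γ)) * φ r + (-(2 * γ) * ‖J r v‖ ^ 2 -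
            2 * ⟪fderiv ℝ U (ODE.evolutionMap (fun _ : ℝ => selfSimilarTransport γ 0 V) 0 (-r) y) (J r v), J r v⟫)) := by
          ring
      _ ≤ 0 := mul_nonpos_of_nonneg_of_nonpos hE.le this
  -- compare `ψ σ` with `ψ 0 = ‖v‖²`
  have hΦ0 : ODE.evolutionMap (fun _ : ℝ => selfSimilarTransport γ 0 V) 0 0 = id :=
    funext (ODE.evolutionMap_self _ 0)
  have hψ0 : ψ 0 = ‖v‖ ^ 2 := by
    simp only [hψ, hφ, hJ, mul_zero, neg_zero, Real.exp_zero, one_mul, hΦ0, fderiv_id,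
      ContinuousLinearMap.coe_id', id_eq]
  have hL : (0 : ℝ) ≤ L := hσ.1.trans hσ.2
  have hle : ψ σ ≤ ψ 0 := hanti (left_mem_Icc.2 hL) hσ hσ.1
  rw [hψ0] at hle
  -- take square roots
  have hsq : ‖J σ v‖ ^ 2 ≤ (Real.exp ((k - γ) * σ) * ‖v‖) ^ 2 := by
    have h2 : (Real.exp ((k - γ) * σ) * ‖v‖) ^ 2 = Real.exp (2 * (k - γ) * σ) * ‖v‖ ^ 2 := by
      rw [mul_pow, ← Real.exp_nat_mul]; ring_nf
    have h3 : Real.exp (2 * (k - γ) * σ) * (Real.exp (-(2 * (k - γ) * σ)) * φ σ) = φ σ := by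
      rw [← mul_assoc, ← Real.exp_add, add_neg_cancel, Real.exp_zero, one_mul]
    rw [h2]
    calc ‖J σ v‖ ^ 2 = Real.exp (2 * (k - γ) * σ) * (Real.exp (-(2 * (k - γ) * σ)) * φ σ) := by rw [h3]
      _ ≤ Real.exp (2 * (k - γ) * σ) * ‖v‖ ^ 2 := mul_le_mul_of_nonneg_left hle (Real.exp_pos _).le
  exact (pow_le_pow_iff_left₀ (norm_nonneg _) (by positivity) two_ne_zero).1 hsq

/-- **(S2) GRÖNWALL UPPER BOUND under a compression bound, operator-norm form**: `‖DΨ_σ(y)‖ ≤ e^{(k−γ)σ}` for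
`σ ∈ [0, L]` along every backward cut-off orbit lingering in `B̄_M` during `[0, L]`, if `−k‖v‖² ≤ ⟪DU(z) v, v⟫` on `B̄_M`.
[cite: ConstantinIgnatovaVicol2026Putative, §3.4.1 eq. (3.22)] -/
theorem norm_fderiv_flow_le_linger (hV : ContDiff ℝ 2 V) {K : ℝ} (hK : ∀ y, ‖fderiv ℝ V y‖ ≤ K)
    {M Rbig : ℝ} (hMR : M < Rbig) (hVU : ∀ w ∈ ball (0 : EuclideanSpace ℝ (Fin 3)) Rbig, V w = U w) {k : ℝ}
    (hk : ∀ z ∈ closedBall (0 : EuclideanSpace ℝ (Fin 3)) M, ∀ v : EuclideanSpace ℝ (Fin 3),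
      -(k * ‖v‖ ^ 2) ≤ ⟪fderiv ℝ U z v, v⟫)
    {y : EuclideanSpace ℝ (Fin 3)} {L : ℝ}
    (hy : ∀ σ ∈ Icc (0 : ℝ) L, ‖ODE.evolutionMap (fun _ : ℝ => selfSimilarTransport γ 0 V) 0 (-σ) y‖ ≤ M)
    {σ : ℝ} (hσ : σ ∈ Icc (0 : ℝ) L) :
    ‖fderiv ℝ (ODE.evolutionMap (fun _ : ℝ => selfSimilarTransport γ 0 V) 0 (-σ)) y‖ ≤ Real.exp ((k - γ) * σ) :=
  ContinuousLinearMap.opNorm_le_bound _ (Real.exp_pos _).le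
    fun v => norm_fderiv_flow_apply_le_linger hV hK hMR hVU hk hy hσ v

/-! ## (S3) The stretching clock -/

/-- **(S3) THE STRETCHING CLOCK, orbit form.**  `(U, P)` a self-similar Euler profile, `V ∈ C²` a cut-off copy
(`‖DV‖ ≤ K`, `V = U` on `ball 0 R_big`), `M < R_big`, stretching rate `⟪DU(z) v, v⟫ ≤ s‖v‖²` on `B̄_M`; if the backward orbit
of `y` lingers in `B̄_M` during `[0, L]` then vorticity GROWS along it at rate at least `1 − s`:
`‖curl U y‖ · e^{(1−s)σ} ≤ ‖curl U (Ψ_σ y)‖` for `σ ∈ [0, L]`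
(t40a `‖Ω(Ψ_σ y)‖ = e^{(1+γ)σ}‖DΨ_σ(y)Ω(y)‖` and (S1) with `v = Ω(y)`).
[cite: ConstantinIgnatovaVicol2026Putative, §3.4.1 eq. (3.23)–(3.24)] -/
theorem norm_curl_mul_exp_le_curl_flow_of_stretching_linger (hprof : IsSelfSimilarEulerProfile γ 0 U P)
    (hV : ContDiff ℝ 2 V) {K : ℝ} (hK : ∀ y, ‖fderiv ℝ V y‖ ≤ K) {M Rbig : ℝ} (hMR : M < Rbig)
    (hVU : ∀ w ∈ ball (0 : EuclideanSpace ℝ (Fin 3)) Rbig, V w = U w) {s : ℝ}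
    (hs : ∀ z ∈ closedBall (0 : EuclideanSpace ℝ (Fin 3)) M, ∀ v : EuclideanSpace ℝ (Fin 3),
      ⟪fderiv ℝ U z v, v⟫ ≤ s * ‖v‖ ^ 2)
    {y : EuclideanSpace ℝ (Fin 3)} {L : ℝ}
    (hy : ∀ σ ∈ Icc (0 : ℝ) L, ‖ODE.evolutionMap (fun _ : ℝ => selfSimilarTransport γ 0 V) 0 (-σ) y‖ ≤ M)
    {σ : ℝ} (hσ : σ ∈ Icc (0 : ℝ) L) :
    ‖curl U y‖ * Real.exp ((1 - s) * σ) ≤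
      ‖curl U (ODE.evolutionMap (fun _ : ℝ => selfSimilarTransport γ 0 V) 0 (-σ) y)‖ := by
  have h1 := norm_fderiv_flow_apply_ge_linger hV hK hMR hVU hs hy hσ (curl U y)
  rw [norm_curl_flow_eq_linger hprof hV hK hMR hVU hy hσ]
  have hexp : Real.exp ((1 - s) * σ) = Real.exp ((1 + γ) * σ) * Real.exp (-((γ + s) * σ)) := by
    rw [← Real.exp_add]; ring_nf
  calc ‖curl U y‖ * Real.exp ((1 - s) * σ)
      = Real.exp ((1 + γ) * σ) * (Real.exp (-((γ + s) * σ)) * ‖curl U y‖) := by rw [hexp]; ring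
    _ ≤ Real.exp ((1 + γ) * σ) *
          ‖fderiv ℝ (ODE.evolutionMap (fun _ : ℝ => selfSimilarTransport γ 0 V) 0 (-σ)) y (curl U y)‖ :=
        mul_le_mul_of_nonneg_left h1 (Real.exp_pos _).le

/-- **(S3) THE STRETCHING CLOCK.**  Under the hypotheses of the orbit form and `‖curl U‖ ≤ O` on `B̄_M`:
`‖curl U y‖ · e^{(1−s)σ} ≤ O` for every `σ ∈ [0, L]` — a label with `‖Ω(y)‖ ≥ ω₀ > 0` lingers in `B̄_M` for backward
time at most `log(O/ω₀)/(1−s)` when the stretching rate is SUBCRITICAL, `s < 1`.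
[cite: ConstantinIgnatovaVicol2026Putative, §3.4.1 eq. (3.23)–(3.24)] -/
theorem norm_curl_mul_exp_le_of_stretching_linger (hprof : IsSelfSimilarEulerProfile γ 0 U P)
    (hV : ContDiff ℝ 2 V) {K : ℝ} (hK : ∀ y, ‖fderiv ℝ V y‖ ≤ K) {M Rbig : ℝ} (hMR : M < Rbig)
    (hVU : ∀ w ∈ ball (0 : EuclideanSpace ℝ (Fin 3)) Rbig, V w = U w) {s : ℝ}
    (hs : ∀ z ∈ closedBall (0 : EuclideanSpace ℝ (Fin 3)) M, ∀ v : EuclideanSpace ℝ (Fin 3),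
      ⟪fderiv ℝ U z v, v⟫ ≤ s * ‖v‖ ^ 2)
    {O : ℝ} (hO : ∀ z ∈ closedBall (0 : EuclideanSpace ℝ (Fin 3)) M, ‖curl U z‖ ≤ O)
    {y : EuclideanSpace ℝ (Fin 3)} {L : ℝ}
    (hy : ∀ σ ∈ Icc (0 : ℝ) L, ‖ODE.evolutionMap (fun _ : ℝ => selfSimilarTransport γ 0 V) 0 (-σ) y‖ ≤ M)
    {σ : ℝ} (hσ : σ ∈ Icc (0 : ℝ) L) :
    ‖curl U y‖ * Real.exp ((1 - s) * σ) ≤ O :=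
  (norm_curl_mul_exp_le_curl_flow_of_stretching_linger hprof hV hK hMR hVU hs hy hσ).trans
    (hO _ (mem_closedBall_zero_iff.2 (hy σ hσ)))

/-- **RESIDENCE-TIME BOUND from the stretching clock.**  Under the hypotheses of (S3) with `s < 1` and a vortical label
`curl U y ≠ 0` lingering in `B̄_M` during `[0, L]`, `L ≥ 0`: `L ≤ log(O/‖curl U y‖)/(1 − s)`. [folklore] -/
theorem linger_time_le_of_stretching (hprof : IsSelfSimilarEulerProfile γ 0 U P)
    (hV : ContDiff ℝ 2 V) {K : ℝ} (hK : ∀ y, ‖fderiv ℝ V y‖ ≤ K) {M Rbig : ℝ} (hMR : M < Rbig)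
    (hVU : ∀ w ∈ ball (0 : EuclideanSpace ℝ (Fin 3)) Rbig, V w = U w) {s : ℝ} (hs1 : s < 1)
    (hs : ∀ z ∈ closedBall (0 : EuclideanSpace ℝ (Fin 3)) M, ∀ v : EuclideanSpace ℝ (Fin 3),
      ⟪fderiv ℝ U z v, v⟫ ≤ s * ‖v‖ ^ 2)
    {O : ℝ} (hO : ∀ z ∈ closedBall (0 : EuclideanSpace ℝ (Fin 3)) M, ‖curl U z‖ ≤ O)
    {y : EuclideanSpace ℝ (Fin 3)} (hΩ : curl U y ≠ 0) {L : ℝ} (hL : 0 ≤ L)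
    (hy : ∀ σ ∈ Icc (0 : ℝ) L, ‖ODE.evolutionMap (fun _ : ℝ => selfSimilarTransport γ 0 V) 0 (-σ) y‖ ≤ M) :
    L ≤ Real.log (O / ‖curl U y‖) / (1 - s) := by
  have hΩn : 0 < ‖curl U y‖ := norm_pos_iff.2 hΩ
  have h := norm_curl_mul_exp_le_of_stretching_linger hprof hV hK hMR hVU hs hO hy (right_mem_Icc.2 hL)
  have h1s : 0 < 1 - s := by linarith
  rw [le_div_iff₀ h1s, mul_comm]
  have h2 : Real.exp ((1 - s) * L) ≤ O / ‖curl U y‖ := by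
    rw [le_div_iff₀ hΩn, mul_comm]; exact h
  have h3 := Real.log_le_log (Real.exp_pos _) h2
  rwa [Real.log_exp] at h3

/-! ## (S4) The compression clock -/

/-- **(S4) THE COMPRESSION CLOCK.**  `(U, P)` a self-similar Euler profile, `V ∈ C²` a cut-off copy (`‖DV‖ ≤ K`,
`V = U` on `ball 0 R_big`), `M < R_big`, compression rate `−k‖v‖² ≤ ⟪DU(z) v, v⟫` on `B̄_M`, `‖curl U‖ ≤ O` on `B̄_M`; if
the backward orbit of `y` lingers in `B̄_M` during `[0, L]` then `‖curl U y‖ · e^{(1−2k)σ} ≤ O` for every `σ ∈ [0, L]`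
(t40c `‖Ω(y)‖e^{(1−2γ)σ} ≤ O‖DΨ_σ(y)‖²` with (S2)² `‖DΨ_σ(y)‖² ≤ e^{2(k−γ)σ}`): a label with `‖Ω(y)‖ ≥ ω₀ > 0` lingers at
most `log(O/ω₀)/(1−2k)` when the compression rate is SUBCRITICAL, `k < 1/2`.  (On the ball `tr DU = 0`, so this
hypothesis implies the stretching bound of (S3) with `s = 2k` and the same rate.)
[cite: ConstantinIgnatovaVicol2026Putative, §3.4.1 eq. (3.22)–(3.24)] -/
theorem norm_curl_mul_exp_le_of_compression_linger (hprof : IsSelfSimilarEulerProfile γ 0 U P)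
    (hV : ContDiff ℝ 2 V) {K : ℝ} (hK : ∀ y, ‖fderiv ℝ V y‖ ≤ K) {M Rbig : ℝ} (hMR : M < Rbig)
    (hVU : ∀ w ∈ ball (0 : EuclideanSpace ℝ (Fin 3)) Rbig, V w = U w) {k : ℝ}
    (hk : ∀ z ∈ closedBall (0 : EuclideanSpace ℝ (Fin 3)) M, ∀ v : EuclideanSpace ℝ (Fin 3),
      -(k * ‖v‖ ^ 2) ≤ ⟪fderiv ℝ U z v, v⟫)
    {O : ℝ} (hO : ∀ z ∈ closedBall (0 : EuclideanSpace ℝ (Fin 3)) M, ‖curl U z‖ ≤ O)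
    {y : EuclideanSpace ℝ (Fin 3)} {L : ℝ}
    (hy : ∀ σ ∈ Icc (0 : ℝ) L, ‖ODE.evolutionMap (fun _ : ℝ => selfSimilarTransport γ 0 V) 0 (-σ) y‖ ≤ M)
    {σ : ℝ} (hσ : σ ∈ Icc (0 : ℝ) L) :
    ‖curl U y‖ * Real.exp ((1 - 2 * k) * σ) ≤ O := by
  have hO0 : 0 ≤ O := (norm_nonneg _).trans (hO _ (mem_closedBall_zero_iff.2 (hy σ hσ)))
  have h1 := norm_fderiv_flow_sq_ge_linger hprof hV hK hMR hVU hO hy σ hσ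
  have h2 := norm_fderiv_flow_le_linger hV hK hMR hVU hk hy hσ
  have h3 : ‖fderiv ℝ (ODE.evolutionMap (fun _ : ℝ => selfSimilarTransport γ 0 V) 0 (-σ)) y‖ ^ 2 ≤
      Real.exp ((k - γ) * σ) ^ 2 := pow_le_pow_left₀ (norm_nonneg _) h2 2
  have h4 : ‖curl U y‖ * Real.exp ((1 - 2 * γ) * σ) ≤ O * Real.exp ((k - γ) * σ) ^ 2 :=
    h1.trans (mul_le_mul_of_nonneg_left h3 hO0)
  have hexp : Real.exp ((1 - 2 * k) * σ) = Real.exp ((1 - 2 * γ) * σ) * Real.exp (-(2 * (k - γ) * σ)) := by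
    rw [← Real.exp_add]; ring_nf
  have hee : Real.exp ((k - γ) * σ) ^ 2 * Real.exp (-(2 * (k - γ) * σ)) = 1 := by
    rw [← Real.exp_nat_mul, ← Real.exp_add]
    convert Real.exp_zero using 2
    push_cast
    ring
  calc ‖curl U y‖ * Real.exp ((1 - 2 * k) * σ)
      = (‖curl U y‖ * Real.exp ((1 - 2 * γ) * σ)) * Real.exp (-(2 * (k - γ) * σ)) := by rw [hexp]; ring
    _ ≤ (O * Real.exp ((k - γ) * σ) ^ 2) * Real.exp (-(2 * (k - γ) * σ)) :=
        mul_le_mul_of_nonneg_right h4 (Real.exp_pos _).le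
    _ = O * (Real.exp ((k - γ) * σ) ^ 2 * Real.exp (-(2 * (k - γ) * σ))) := by ring
    _ = O := by rw [hee, mul_one]

/-- **RESIDENCE-TIME BOUND from the compression clock.**  Under the hypotheses of (S4) with `k < 1/2` and a vortical
label `curl U y ≠ 0` lingering in `B̄_M` during `[0, L]`, `L ≥ 0`: `L ≤ log(O/‖curl U y‖)/(1 − 2k)`. [folklore] -/
theorem linger_time_le_of_compression (hprof : IsSelfSimilarEulerProfile γ 0 U P)
    (hV : ContDiff ℝ 2 V) {K : ℝ} (hK : ∀ y, ‖fderiv ℝ V y‖ ≤ K) {M Rbig : ℝ} (hMR : M < Rbig)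
    (hVU : ∀ w ∈ ball (0 : EuclideanSpace ℝ (Fin 3)) Rbig, V w = U w) {k : ℝ} (hk2 : k < 1 / 2)
    (hk : ∀ z ∈ closedBall (0 : EuclideanSpace ℝ (Fin 3)) M, ∀ v : EuclideanSpace ℝ (Fin 3),
      -(k * ‖v‖ ^ 2) ≤ ⟪fderiv ℝ U z v, v⟫)
    {O : ℝ} (hO : ∀ z ∈ closedBall (0 : EuclideanSpace ℝ (Fin 3)) M, ‖curl U z‖ ≤ O)
    {y : EuclideanSpace ℝ (Fin 3)} (hΩ : curl U y ≠ 0) {L : ℝ} (hL : 0 ≤ L)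
    (hy : ∀ σ ∈ Icc (0 : ℝ) L, ‖ODE.evolutionMap (fun _ : ℝ => selfSimilarTransport γ 0 V) 0 (-σ) y‖ ≤ M) :
    L ≤ Real.log (O / ‖curl U y‖) / (1 - 2 * k) := by
  have hΩn : 0 < ‖curl U y‖ := norm_pos_iff.2 hΩ
  have h := norm_curl_mul_exp_le_of_compression_linger hprof hV hK hMR hVU hk hO hy (right_mem_Icc.2 hL)
  have h1k : 0 < 1 - 2 * k := by linarith
  rw [le_div_iff₀ h1k, mul_comm]
  have h2 : Real.exp ((1 - 2 * k) * L) ≤ O / ‖curl U y‖ := by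
    rw [le_div_iff₀ hΩn, mul_comm]; exact h
  have h3 := Real.log_le_log (Real.exp_pos _) h2
  rwa [Real.log_exp] at h3

end Summit.NavierStokesRegularity.NavierStokesRegularity.Theorems.PowerGaugeEulerLiouville.NeedleClock

end
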